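import Summits.QuantumFields.BalabanUV.T4Continuum.Support.NE3ProductPathBounds
import Literature.MathematicalPhysics.QuantumFieldTheory.Balaban1983to89.BlockAveragingSU2FirstOrder
import HarnessLib

/-!
# T⁴ programme, node NE3 — route Π, bounds for the product path (2∕2): the pointwise sizes of the product path's
# conjugated normal part, velocity deviation, acceleration, bond radius and log-coordinates

NE3 (node U1b), row NE3 OWNER `b2b-balaban-t4-ne3-p1` (gen 24); route Π, design note `D-ne3p1-g24-1.md` §4; companion of `NE3ProductPath`
(exact formulas) and `NE3ProductPathBounds` (energy-norm algebra); input of `NE3ProductPathChart`.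

CONTENT ([folklore]; 0 def, 0 sorry), on `[0,1]` under `‖X b‖ ≤ α ≤ 1∕32`, `‖N b‖ ≤ αN ≤ 1∕64`: `conjN_eq_Ad`, `norm_conjN_eq` (`‖C t b‖ = ‖N b‖`),
`norm_conjN_sub_le` (`‖C t b − N b‖ ≤ 4α‖N b‖`), `norm_vel_sub_le` (`‖Ψ t b − X b‖ ≤ 2‖N b‖`), `norm_acc_le` (`‖Ψ′ t b‖ ≤ (2 + 4α)‖N b‖`),
`norm_prodM_sub_one_le_lin` (`‖P t b − 1‖ ≤ 3(‖X b‖ + ‖N b‖) ∧ ≤ 3(α + αN)`), `pathΓ_eq_mlog`, `norm_pathΓ_le` (`‖Γ t b‖ ≤ 6(α + αN)`),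
`norm_pathΓ_zero_sub_le` (`‖Γ 0 b − (N b − X b)‖ ≤ 23(α + αN)·(‖N b‖ + ‖X b‖)`).

HONEST FRAMING.  Elementary inequalities; nothing about Bałaban's minimisers; NE3 NOT proved; spine PROVED 0∕9; finite T⁴ rung (B)+1 —
NOT infinite volume, NOT mass gap, NOT `BetaPertH`, NOT Clay.  PLACEMENT: `Summits/QuantumFields/BalabanUV/`.  HONEST DEPENDENCY:
continuum YM on T⁴ ⇐ BetaPertH ∧ nine spine estimates (0/9 proved); BetaPertH ⇐ (D1) ∧ (D4) ∧ CAP+tail; G-an2-4 gates asym, D1 and NE2/3/4.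
-/

set_option autoImplicit false

open scoped BigOperators Matrix.Norms.L2Operator
open NormedSpace Finset

namespace Summit.QuantumFields.BalabanUV.T4Continuum.NE3ProductPathSizes

open Set
open Literature.MathematicalPhysics.QuantumFieldTheory.Balaban1983to89
open B7Prop1Explicit B7Prop2Explicit MatrixLog
open T4AveragingDeficitWall (IsSkewDir IsUnitaryCfg vary Ad curl curlAt curlSq dirSq dirL1)
open AveragingDeficitPeriodicCounting (IsPeriodicDir)
open AveragingDeficitTransport (norm_Ad_of_unitary)
open AveragingDeficitNearIdentity (Ad_one)
open AveragingDeficitBlockDensity (norm_exp_sub_one_le_two_mul)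
open NE3CurlStability (norm_Ad_sub_Ad_le)
open NE3HessContinuity (bondL1 bondL1At)
open NE3ProductPath
open NE3ProductPathBounds

noncomputable section

variable {d : ℕ} {n : Type*} [Fintype n] [DecidableEq n]

/-! ## §4 Pointwise sizes along the product path -/

/-- `C t b = Ad_{expUnit((1−t)•X b)} (N b)`. [folklore] -/
theorem conjN_eq_Ad (X N : Matrix n n ℂ) (t : ℝ) :
    conjN X N t = Ad (expUnit ((((1 - t) : ℝ) : ℂ) • X)) N := by
  unfold conjN Ad
  rw [val_inv_expUnit, val_expUnit, val_expUnit, ← neg_smul]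
  congr 2
  push_cast; ring

/-- `‖C t b‖ = ‖N b‖` for skew `X` (unitary conjugation). [folklore] -/
theorem norm_conjN_eq {X : Matrix n n ℂ} (hX : X ∈ skewAdjoint (Matrix n n ℂ)) (N : Matrix n n ℂ) (t : ℝ) :
    ‖conjN X N t‖ = ‖N‖ := by
  rw [conjN_eq_Ad]
  refine norm_Ad_of_unitary ?_ N
  rw [mem_unitaryUnits, val_expUnit]
  exact exp_real_smul_mem_unitary hX _

/-- `‖e^{c•X} − 1‖ ≤ 2|c|‖X‖` when `|c|‖X‖ ≤ 1`. [folklore] -/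
theorem norm_exp_real_smul_sub_one_le {X : Matrix n n ℂ} {c : ℝ} (h : |c| * ‖X‖ ≤ 1) :
    ‖exp (((c : ℝ) : ℂ) • X) - 1‖ ≤ 2 * (|c| * ‖X‖) := by
  have hn : ‖(((c : ℝ) : ℂ) • X)‖ = |c| * ‖X‖ := by rw [norm_smul, Complex.norm_real, Real.norm_eq_abs]
  have := norm_exp_sub_one_le_two_mul (X := ((c : ℝ) : ℂ) • X) (by rw [hn]; exact h)
  rwa [hn] at this

/-- **`‖C t b − N b‖ ≤ 4α·‖N b‖`** on `[0,1]` for skew `X` with `‖X‖ ≤ α ≤ 1` (`Ad_g N − Ad_1 N` with `‖g − 1‖ ≤ 2α`). [folklore] -/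
theorem norm_conjN_sub_le [Nonempty n] {X N : Matrix n n ℂ} (hX : X ∈ skewAdjoint (Matrix n n ℂ)) {α : ℝ} (hXα : ‖X‖ ≤ α)
    (hα1 : α ≤ 1) {t : ℝ} (ht : t ∈ Icc (0:ℝ) 1) : ‖conjN X N t - N‖ ≤ 4 * α * ‖N‖ := by
  have hu : expUnit ((((1 - t) : ℝ) : ℂ) • X) ∈ unitaryUnits (Matrix n n ℂ) := by
    rw [mem_unitaryUnits, val_expUnit]; exact exp_real_smul_mem_unitary hX _
  have h1 : (1 : (Matrix n n ℂ)ˣ) ∈ unitaryUnits (Matrix n n ℂ) := Subgroup.one_mem _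
  have h := norm_Ad_sub_Ad_le h1 hu N
  rw [Ad_one] at h
  rw [conjN_eq_Ad]
  refine h.trans ?_
  have hc : |1 - t| * ‖X‖ ≤ α := by
    rw [abs_of_nonneg (by linarith [ht.2])]
    have := mul_le_mul (show 1 - t ≤ 1 by linarith [ht.1]) hXα (norm_nonneg _) zero_le_one
    linarith
  have he := norm_exp_real_smul_sub_one_le (X := X) (c := 1 - t) (hc.trans hα1)
  rw [val_expUnit, Units.val_one] at *
  have hN := norm_nonneg N
  nlinarith [he, hc, norm_nonneg (exp ((((1 - t) : ℝ) : ℂ) • X) - 1)]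

/-- `‖Ψ t b − X b‖ ≤ 2‖N b‖` on `[0,1]` (skew `X`). [folklore] -/
theorem norm_vel_sub_le {X : Matrix n n ℂ} (hX : X ∈ skewAdjoint (Matrix n n ℂ)) (N : Matrix n n ℂ) {t : ℝ} (ht : t ∈ Icc (0:ℝ) 1) :
    ‖vel X N t - X‖ ≤ 2 * ‖N‖ := by
  have h : vel X N t - X = (((-2 * (1 - t)) : ℝ) : ℂ) • conjN X N t := by unfold vel; abel
  rw [h, norm_smul, Complex.norm_real, Real.norm_eq_abs, norm_conjN_eq hX]
  have : |-2 * (1 - t)| ≤ 2 := by rw [abs_le]; constructor <;> nlinarith [ht.1, ht.2]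
  exact mul_le_mul_of_nonneg_right this (norm_nonneg _)

/-- `‖Ψ′ t b‖ ≤ (2 + 4α)‖N b‖` on `[0,1]` for skew `X` with `‖X‖ ≤ α`. [folklore] -/
theorem norm_acc_le {X : Matrix n n ℂ} (hX : X ∈ skewAdjoint (Matrix n n ℂ)) {α : ℝ} (hXα : ‖X‖ ≤ α) (N : Matrix n n ℂ)
    {t : ℝ} (ht : t ∈ Icc (0:ℝ) 1) : ‖acc X N t‖ ≤ (2 + 4 * α) * ‖N‖ := by
  unfold acc
  have hC := norm_conjN_eq hX N t
  have h1 : ‖((2 : ℝ) : ℂ) • conjN X N t‖ = 2 * ‖N‖ := by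
    rw [norm_smul, Complex.norm_real, Real.norm_eq_abs, abs_of_pos (by norm_num : (0:ℝ) < 2), hC]
  have h2 : ‖(((2 * (1 - t)) : ℝ) : ℂ) • (X * conjN X N t - conjN X N t * X)‖ ≤ 4 * α * ‖N‖ := by
    rw [norm_smul, Complex.norm_real, Real.norm_eq_abs, abs_of_nonneg (by nlinarith [ht.2] : (0:ℝ) ≤ 2 * (1 - t))]
    have hcomm : ‖X * conjN X N t - conjN X N t * X‖ ≤ 2 * (α * ‖N‖) := by
      calc ‖X * conjN X N t - conjN X N t * X‖ ≤ ‖X * conjN X N t‖ + ‖conjN X N t * X‖ := norm_sub_le _ _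
        _ ≤ ‖X‖ * ‖conjN X N t‖ + ‖conjN X N t‖ * ‖X‖ := add_le_add (norm_mul_le _ _) (norm_mul_le _ _)
        _ ≤ 2 * (α * ‖N‖) := by rw [hC]; nlinarith [norm_nonneg N, norm_nonneg X]
    have ht' : 2 * (1 - t) ≤ 2 := by linarith [ht.1]
    have h0 : 0 ≤ α * ‖N‖ := mul_nonneg ((norm_nonneg X).trans hXα) (norm_nonneg N)
    nlinarith [hcomm, ht', ht.2]
  exact (norm_add_le _ _).trans (by rw [h1]; linarith)

/-- **THE MOVING BOND STAYS NEAR `W`**: `‖P t − 1‖ ≤ 3(α + αN)` on `[0,1]` for `‖X‖ ≤ α ≤ 1∕32`, `‖N‖ ≤ αN ≤ 1∕64`;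
also `‖P t − 1‖ ≤ 3(‖X‖ + ‖N‖)` (the relative form). [folklore] -/
theorem norm_prodM_sub_one_le_lin {X N : Matrix n n ℂ} {α αN : ℝ} (hXα : ‖X‖ ≤ α) (hNα : ‖N‖ ≤ αN) (hα : α ≤ 1 / 32)
    (hαN : αN ≤ 1 / 64) {t : ℝ} (ht : t ∈ Icc (0:ℝ) 1) :
    ‖prodM X N t - 1‖ ≤ 3 * (‖X‖ + ‖N‖) ∧ ‖prodM X N t - 1‖ ≤ 3 * (α + αN) := by
  have hX1 : |t - 1| * ‖X‖ ≤ ‖X‖ := by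
    have : |t - 1| ≤ 1 := by rw [abs_le]; constructor <;> linarith [ht.1, ht.2]
    nlinarith [norm_nonneg X]
  have hN1 : |(1 - t) ^ 2| * ‖N‖ ≤ ‖N‖ := by
    have h1 : (1 - t) ^ 2 ≤ 1 := by nlinarith [ht.1, ht.2]
    rw [abs_of_nonneg (sq_nonneg _)]; nlinarith [norm_nonneg N]
  have hu := norm_exp_real_smul_sub_one_le (X := X) (c := t - 1) (hX1.trans (hXα.trans (by linarith)))
  have hv := norm_exp_real_smul_sub_one_le (X := N) (c := (1 - t) ^ 2) (hN1.trans (hNα.trans (by linarith)))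
  have h := norm_exp_mul_exp_sub_one_le ((((t - 1) : ℝ) : ℂ) • X) ((((1 - t) ^ 2 : ℝ) : ℂ) • N)
  have hu' : ‖exp ((((t - 1) : ℝ) : ℂ) • X) - 1‖ ≤ 2 * ‖X‖ := hu.trans (by linarith)
  have hv' : ‖exp ((((1 - t) ^ 2 : ℝ) : ℂ) • N) - 1‖ ≤ 2 * ‖N‖ := hv.trans (by linarith)
  have h0 := norm_nonneg (exp ((((t - 1) : ℝ) : ℂ) • X) - 1)
  have h0' := norm_nonneg (exp ((((1 - t) ^ 2 : ℝ) : ℂ) • N) - 1)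
  have hXn := norm_nonneg X; have hNn := norm_nonneg N
  have hP : ‖prodM X N t - 1‖ ≤ 2 * ‖N‖ * (2 * ‖X‖) + 2 * ‖N‖ + 2 * ‖X‖ := by
    unfold prodM expN expX
    nlinarith [h, mul_le_mul hv' hu' h0 (by linarith)]
  constructor
  · nlinarith [hP, hXα, hNα]
  · nlinarith [hP, hXα, hNα]

/-- On `[0,1]` the log-coordinate IS the logarithm: `Γ t b = mlog (P t b)` (skewness of the log of a unitary near `1`). [folklore] -/
theorem pathΓ_eq_mlog {X N : Site d → Fin d → Matrix n n ℂ} (hXs : IsSkewDir X) (hNs : IsSkewDir N)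
    (hX : ∀ x μ, ‖X x μ‖ ≤ 1 / 32) (hN : ∀ x μ, ‖N x μ‖ ≤ 1 / 64) {t : ℝ} (ht : t ∈ Icc (0:ℝ) 1) (x : Site d) (μ : Fin d) :
    pathΓ X N t x μ = mlog (prodM (X x μ) (N x μ) t) := by
  have h14 := norm_prodM_sub_one_le (hX x μ) (hN x μ) (s := t) (by rw [abs_le]; constructor <;> linarith [ht.1, ht.2])
  have hskew : mlog (prodM (X x μ) (N x μ) t) ∈ skewAdjoint (Matrix n n ℂ) := by
    rw [skewAdjoint.mem_iff]
    exact ExpMeanLog.star_mlog_eq_neg (prodM_mem_unitary (hXs x μ) (hNs x μ) t) (h14.trans (by norm_num))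
  exact skewHalf_eq_self hskew

/-- **THE SUP-RADIUS OF THE PATH**: `‖Γ t b‖ ≤ 6(α + αN)` on `[0,1]` (`‖log P‖ ≤ 2‖P − 1‖`). [folklore] -/
theorem norm_pathΓ_le {X N : Site d → Fin d → Matrix n n ℂ} (hXs : IsSkewDir X) (hNs : IsSkewDir N) {α αN : ℝ}
    (hXα : ∀ x μ, ‖X x μ‖ ≤ α) (hNα : ∀ x μ, ‖N x μ‖ ≤ αN) (hα : α ≤ 1 / 32) (hαN : αN ≤ 1 / 64)
    {t : ℝ} (ht : t ∈ Icc (0:ℝ) 1) (x : Site d) (μ : Fin d) : ‖pathΓ X N t x μ‖ ≤ 6 * (α + αN) := by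
  have hX' : ∀ x μ, ‖X x μ‖ ≤ 1 / 32 := fun x μ => (hXα x μ).trans hα
  have hN' : ∀ x μ, ‖N x μ‖ ≤ 1 / 64 := fun x μ => (hNα x μ).trans hαN
  rw [pathΓ_eq_mlog hXs hNs hX' hN' ht]
  have hP := (norm_prodM_sub_one_le_lin (hXα x μ) (hNα x μ) hα hαN ht).2
  have hhalf : ‖prodM (X x μ) (N x μ) t - 1‖ ≤ 1 / 2 := hP.trans (by linarith)
  exact (norm_mlog_le_two_mul hhalf).trans (by linarith)

/-- **THE START OF THE PATH vs `N − X`**: `‖Γ 0 b − (N b − X b)‖ ≤ 23(α + αN)·(‖N b‖ + ‖X b‖)` (second-order expansions of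
`log` and `exp`: `‖log P − (P − 1)‖ ≤ ‖P − 1‖²`, `‖e^N e^{−X} − 1 − (N − X)‖ ≤ ‖e^N − 1‖‖e^{−X} − 1‖ + ‖e^N − 1 − N‖ + ‖e^{−X} − 1 + X‖`).
[folklore] -/
theorem norm_pathΓ_zero_sub_le {X N : Site d → Fin d → Matrix n n ℂ} (hXs : IsSkewDir X) (hNs : IsSkewDir N) {α αN : ℝ}
    (hXα : ∀ x μ, ‖X x μ‖ ≤ α) (hNα : ∀ x μ, ‖N x μ‖ ≤ αN) (hα : α ≤ 1 / 32) (hαN : αN ≤ 1 / 64) (x : Site d) (μ : Fin d) :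
    ‖pathΓ X N 0 x μ - (N x μ - X x μ)‖ ≤ 23 * (α + αN) * (‖N x μ‖ + ‖X x μ‖) := by
  have hX' : ∀ x μ, ‖X x μ‖ ≤ 1 / 32 := fun x μ => (hXα x μ).trans hα
  have hN' : ∀ x μ, ‖N x μ‖ ≤ 1 / 64 := fun x μ => (hNα x μ).trans hαN
  have h0 : (0:ℝ) ∈ Icc (0:ℝ) 1 := ⟨le_rfl, zero_le_one⟩
  rw [pathΓ_eq_mlog hXs hNs hX' hN' h0, prodM_zero]
  set A := X x μ; set B := N x μ
  have hAn := norm_nonneg A; have hBn := norm_nonneg B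
  have hα0 : 0 ≤ α := hAn.trans (hXα x μ); have hαN0 : 0 ≤ αN := hBn.trans (hNα x μ)
  -- the product vs its linearisation
  have hP0 : prodM A B 0 = exp B * exp (-A) := prodM_zero A B
  obtain ⟨hPrel, hPabs⟩ := norm_prodM_sub_one_le_lin (X := A) (N := B) (hXα x μ) (hNα x μ) hα hαN h0
  rw [hP0] at hPrel hPabs
  have hlog : ‖mlog (exp B * exp (-A)) - (exp B * exp (-A) - 1)‖ ≤ ‖exp B * exp (-A) - 1‖ ^ 2 :=
    norm_mlog_sub_sub_one_le_sq (hPabs.trans (by linarith))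
  have hsq : ‖exp B * exp (-A) - 1‖ ^ 2 ≤ 3 * (α + αN) * (3 * (‖A‖ + ‖B‖)) :=
    by nlinarith [hPrel, hPabs, norm_nonneg (exp B * exp (-A) - 1)]
  -- the exponentials vs their linearisations
  have hB1 := norm_exp_sub_one_le_of_norm_le (le_refl ‖B‖)
  have hA1 := norm_exp_sub_one_le_of_norm_le (show ‖-A‖ ≤ ‖A‖ by rw [norm_neg])
  have hremB : ‖exp B - 1 - B‖ ≤ ‖B‖ ^ 2 := hB1.2.trans (expRem_le_sq hBn (by linarith [hN' x μ]))
  have hremA : ‖exp (-A) - 1 - (-A)‖ ≤ ‖A‖ ^ 2 := hA1.2.trans (expRem_le_sq hAn (by linarith [hX' x μ]))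
  have huB : ‖exp B - 1‖ ≤ 2 * ‖B‖ := norm_exp_sub_one_le_two_mul ((hN' x μ).trans (by norm_num))
  have huA : ‖exp (-A) - 1‖ ≤ 2 * ‖A‖ := by
    have := norm_exp_sub_one_le_two_mul (X := -A) (by rw [norm_neg]; exact (hX' x μ).trans (by norm_num))
    rwa [norm_neg] at this
  have hmul := norm_mul_sub_one_sub_le (exp B) (exp (-A)) B (-A)
  have hlin : ‖exp B * exp (-A) - 1 - (B - A)‖ ≤ (4 * α + αN) * ‖B‖ + α * ‖A‖ := by
    rw [sub_eq_add_neg B A]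
    refine hmul.trans ?_
    have h1 : ‖exp B - 1‖ * ‖exp (-A) - 1‖ ≤ 2 * ‖B‖ * (2 * ‖A‖) :=
      mul_le_mul huB huA (norm_nonneg _) (by linarith)
    nlinarith [h1, hremB, hremA, hXα x μ, hNα x μ]
  -- assemble
  have e : mlog (exp B * exp (-A)) - (B - A)
      = (mlog (exp B * exp (-A)) - (exp B * exp (-A) - 1)) + (exp B * exp (-A) - 1 - (B - A)) := by abel
  rw [e]
  refine (norm_add_le _ _).trans ?_
  nlinarith [hlog, hsq, hlin, hα0, hαN0]

/-! ## §5 A relative pointwise bound passes to `bondL1` -/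

/-- A pointwise relative bound passes to `bondL1`. [folklore] -/
theorem bondL1_le_of_pointwise {Z Y : Site d → Fin d → Matrix n n ℂ} {c : ℝ} (h : ∀ x μ, ‖Z x μ‖ ≤ c * ‖Y x μ‖)
    (p : T4AveragingDeficitWall.Plaq d) : bondL1 Z p ≤ c * bondL1 Y p := by
  unfold bondL1 bondL1At
  have h1 := h p.1 p.2.1.1; have h2 := h (p.1 + e p.2.1.1) p.2.1.2; have h3 := h (p.1 + e p.2.1.2) p.2.1.1; have h4 := h p.1 p.2.1.2
  linarith

end

end Summit.QuantumFields.BalabanUV.T4Continuum.NE3ProductPathSizes
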